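import Literature.AlgebraicGeometry.Motives.SubschemeCyclesProofs
import HarnessLib

/-!
# Flat pull-back on Chow groups of schemes of finite type: functoriality and push–pull

`Literature.AlgebraicGeometry.Motives.SubschemeCycles` records Fulton's Theorem 1.7 (flat pull-back
preserves rational equivalence) twice: as `flatPullback_mem_ratTrivial`, stated for schemes merely
*locally* of finite type over a field — which is **false** and formally refuted
(`Literature.AlgebraicGeometry.Motives.not_flatPullback_mem_ratTrivial`, file
`SubschemeCyclesFlatPullbackRatProofs`) — and as the corrected, finite-type named fact
`flatPullback_mem_ratTrivial_of_finiteType` (Fulton, *Intersection Theory*, Thm. 1.7 as printed: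
§1.1 and App. B.1.1, all schemes algebraic), on which `ChowGroup.flatPullbackOfFiniteType`
(`f^* : CH_d Y → CH_{d+e} X`) is built.

Every statement consuming a witness `(hrat : flatPullback_mem_ratTrivial)` is vacuous
(`ChowGroup.flatPullback_comp`, and `chowGroup_flatPullback_comp`,
`chowGroup_pushforward_flatPullback` of `CyclesEquivalences`). This file supplies their
non-vacuous finite-type counterparts for `ChowGroup.flatPullbackOfFiniteType`, proved:

* `Literature.AlgebraicGeometry.Motives.ChowGroup.flatPullbackOfFiniteType_comp`: functoriality
  `(g ∘ f)^* = f^* ∘ g^* : CH_d Z → CH_{d+(e'+e)} X` (Fulton §1.7, p. 18: "flat pull-backs are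
  functorial"), from the cycle-level identity `stalkLength_fiber_comp` (multiplicativity of fibre
  multiplicities, Fulton Lemma A.4.1) exactly as `ChowGroup.flatPullback_comp_holds`;
* `Literature.AlgebraicGeometry.Motives.ChowGroup.pushforward_flatPullbackOfFiniteType`: Fulton's
  Proposition 1.7 on Chow groups, `g^* f_* = f'_* g'^* : CH_d X → CH_{d+e} Y'` for a cartesian
  square with `f` proper and `g` flat of relative dimension `e`, by passing to the quotient in the
  cycle-level named fact `pushforward_flatPullback` (Fulton Prop. 1.7 as printed, hypothesis
  `hpp`); the push-forwards need Fulton's Thm. 1.4 (`map_mem_ratTrivial`, hypotheses `hpush`,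
  `hpush'`).

## References

* W. Fulton, *Intersection Theory* (2nd ed., 1998), §1.4 (Thm. 1.4), §1.7 (p. 18; Thm. 1.7,
  Prop. 1.7), Lemma A.4.1 (p. 413).
* The Stacks Project, Chapter 42 (Chow homology), Tags 02RA (composition of flat pull-backs),
  02RG (push and pull), 02S1 (flat pull-back and rational equivalence).
-/

universe u

open CategoryTheory AlgebraicGeometry Limits

noncomputable section

namespace Literature.AlgebraicGeometry.Motives

variable {k : Type u} [Field k] {X Y Z : SchemeOver k} (d : ℕ)

/-- **Fulton, Intersection Theory, §1.7: `(gf)^* = f^* g^*` on Chow groups of schemes of finite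
type.** For flat morphisms `f : X ⟶ Y`, `g : Y ⟶ Z` of finite type, of relative dimensions `e`,
`e'`, between schemes of finite type over a field, the finite-type flat pull-backs
`ChowGroup.flatPullbackOfFiniteType` (built on Fulton's Thm. 1.7 as printed,
`flatPullback_mem_ratTrivial_of_finiteType`, hypothesis `hrat`) compose:
`(f ≫ g)^* = f^* ∘ g^* : CH_d Z → CH_{d+(e'+e)} X`, up to the transport
`CH_{d+e'+e} X ≃ CH_{d+(e'+e)} X` (`ChowGroup.congr`). Coefficientwise this is the
multiplicativity of fibre multiplicities `ℓ(𝒪_{X_{gfx},x}) = ℓ(𝒪_{Y_{gfx},fx}) · ℓ(𝒪_{X_{fx},x})`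
(`stalkLength_fiber_comp`, Fulton Lemma A.4.1), as in `ChowGroup.flatPullback_comp_holds`; this is
the non-vacuous counterpart of the latter, whose hypothesis `flatPullback_mem_ratTrivial` is
refuted (`not_flatPullback_mem_ratTrivial`). [cite: Fulton1998, §1.7] -/
theorem ChowGroup.flatPullbackOfFiniteType_comp (f : X ⟶ Y) (g : Y ⟶ Z) [Flat f.left]
    [Flat g.left] [Flat (f ≫ g).left] [LocallyOfFiniteType f.left] [LocallyOfFiniteType g.left]
    [LocallyOfFiniteType (f ≫ g).left] [QuasiCompact f.left] [QuasiCompact g.left]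
    [QuasiCompact (f ≫ g).left] [LocallyOfFiniteType Y.hom] [LocallyOfFiniteType Z.hom]
    [QuasiCompact Y.hom] [QuasiCompact Z.hom] (hf : locallyFinsupp_flatPullbackFun.{u})
    (hdim : flatPullback_mem_cyclesOfDim.{u}) (hrat : flatPullback_mem_ratTrivial_of_finiteType.{u})
    {e e' : ℕ} (he : f.left.IsEquidimensional e) (he' : g.left.IsEquidimensional e')
    (h : (f ≫ g).left.IsEquidimensional (e' + e)) :
    ChowGroup.flatPullbackOfFiniteType d (f ≫ g) hf hdim hrat h =
      (ChowGroup.congr X.left (Nat.add_assoc d e' e)).toAddMonoidHom.comp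
        ((ChowGroup.flatPullbackOfFiniteType (d + e') f hf hdim hrat he).comp
          (ChowGroup.flatPullbackOfFiniteType d g hf hdim hrat he')) := by
  refine AddMonoidHom.ext fun a ↦ ?_
  induction a using ChowGroup.induction_on with
  | h c =>
    simp only [AddMonoidHom.coe_comp, AddEquiv.coe_toAddMonoidHom, Function.comp_apply,
      ChowGroup.flatPullbackOfFiniteType_mk, ChowGroup.congr_mk]
    congr 1
    refine Subtype.ext ?_
    simp only [coe_cyclesOfDimFlatPullback]
    have hcomp : (f ≫ g).left = f.left ≫ g.left := rfl
    ext x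
    simp only [flatPullback_apply, fundamentalCycleFun_apply]
    rw [hcomp, stalkLength_fiber_comp f.left g.left x]
    push_cast
    simp only [Scheme.Hom.comp_apply, mul_assoc]

/-- **Fulton, Intersection Theory, Prop. 1.7 on Chow groups of schemes of finite type** (Stacks
Project, Tag 02RG). For a cartesian square
```
X' -g'→ X
f'↓     ↓f
Y' -g→  Y
```
of schemes of finite type over a field with `f` (hence `f'`) proper and `g` (hence `g'`) flat of
finite type of relative dimension `e`, proper push-forward and the finite-type flat pull-back
commute on classes: `g^* (f_* x) = f'_* (g'^* x)` in `CH_{d+e} Y'` for every `x ∈ CH_d X`. Proved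
by passing to the quotient in the cycle-level named fact `pushforward_flatPullback` (Fulton
Prop. 1.7 as printed, an identity in `Z_* Y'`; hypothesis `hpp`); `f_*`, `f'_*` on Chow groups
need Fulton's Thm. 1.4 (`map_mem_ratTrivial`, hypotheses `hpush`, `hpush'`) and `g^*`, `g'^*` need
Thm. 1.7 (`flatPullback_mem_ratTrivial_of_finiteType`, hypothesis `hrat`). The non-vacuous
counterpart of `chowGroup_pushforward_flatPullback` (`CyclesEquivalences`), whose hypothesis
`flatPullback_mem_ratTrivial` is refuted. [cite: Fulton1998, Proposition 1.7] -/
theorem ChowGroup.pushforward_flatPullbackOfFiniteType {e : ℕ}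
    (hpp : pushforward_flatPullback.{u}) (hpush : map_mem_ratTrivial d (k := k))
    (hpush' : map_mem_ratTrivial (d + e) (k := k)) (hf : locallyFinsupp_flatPullbackFun.{u})
    (hdim : flatPullback_mem_cyclesOfDim.{u}) (hrat : flatPullback_mem_ratTrivial_of_finiteType.{u})
    {X' Y' : SchemeOver k} (f : X ⟶ Y) (g : Y' ⟶ Y) (f' : X' ⟶ Y') (g' : X' ⟶ X)
    (H : IsPullback g'.left f'.left f.left g.left) [IsProper f.left] [IsProper f'.left]
    [Flat g.left] [Flat g'.left] [LocallyOfFiniteType g.left] [LocallyOfFiniteType g'.left]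
    [QuasiCompact g.left] [QuasiCompact g'.left] [LocallyOfFiniteType X.hom]
    [LocallyOfFiniteType Y.hom] [LocallyOfFiniteType X'.hom] [LocallyOfFiniteType Y'.hom]
    [QuasiCompact X.hom] [QuasiCompact Y.hom] (he : g.left.IsEquidimensional e)
    (he' : g'.left.IsEquidimensional e) (x : ChowGroup X.left d) :
    ChowGroup.flatPullbackOfFiniteType d g hf hdim hrat he (ChowGroup.pushforward d hpush f x) =
      ChowGroup.pushforward (d + e) hpush' f'
        (ChowGroup.flatPullbackOfFiniteType d g' hf hdim hrat he' x) := by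
  induction x using ChowGroup.induction_on with
  | h c =>
    rw [ChowGroup.pushforward_mk, ChowGroup.flatPullbackOfFiniteType_mk,
      ChowGroup.flatPullbackOfFiniteType_mk, ChowGroup.pushforward_mk]
    congr 1
    apply Subtype.ext
    simp only [coe_cyclesOfDimFlatPullback, coe_cyclesOfDimMap]
    exact hpp f g f' g' H hf he he' c

end Literature.AlgebraicGeometry.Motives

end
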